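import Literature.NumberTheory.Automorphic.GL2ComplexCasimirScalar
import Literature.NumberTheory.Automorphic.HarishChandraGLParameterOfCharacter
import HarnessLib

/-!
# The Harish-Chandra polynomial of the Casimir element of `𝔤𝔩ₙ(ℝ)` and of `𝔤𝔩ₙ(ℂ)` (as a real Lie
# algebra), for every `n`: `γ(C)(x) = ∑_i x_i² - |ρ|²`, `γ(C₊)(x) = 2 ∑_τ (∑_i x_{τ,i}² - |ρ|²)`

Topic `NumberTheory/Automorphic`; namespaces `Literature.NumberTheory.Automorphic.GLnCasimir` (real case,
the Casimir element `GLnCasimir.casimir n = ∑_{a,b} E_{ab}E_{ba}` of `GL2CasimirScalar`) and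
`…GLnComplexCasimir` (complex case, the real Casimir element `casPlus n = ∑ (E_{ab}E_{ba} - (iE_{ab})(iE_{ba}))`
of `GL2ComplexCasimirScalar`, i.e. the Casimir element of `Re tr(XY)`).  Theorems only (no definition, no
named fact, no `sorry`): the general-`n` versions of `GL2Casimir.aeval_harishChandra_casimirZ`,
`GL2Casimir.lift_casimir_eq_of_hasHCParameter` (`n = 2`, `𝕜 = ℝ`) and `GL2ComplexCasimir.aeval_hc_casPlus`,
`GLnComplexCasimir.scalars_of_hasHCParameter` (`n = 2`, `𝕜 = ℂ`), by the same method — evaluate on the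
highest weight vector of weight `x - ρ` of the model of `HarishChandraGLModel`
[cite: Knapp2002, §V.5 Lemma 5.42, (5.43), Thm. 5.44]:

* `sum_sum_ite_lt_sub` — `∑_{a<b} (f_a - f_b) = 2 ∑_a ρ_a f_a` (`ρ_a = (n-1)/2 - a`), and the scalar
  `hwCasimirScalar`: `∑_a f_a² + ∑_{a<b} (f_a - f_b) = ∑_a f_a² + 2 ∑_a ρ_a f_a`;
* real case: `lift_casimir_apply_of_isHighestWeightVector` — on a highest weight vector of weight `l`,
  `C v = (∑_a l_a² + 2 ∑_a ρ_a l_a) v = (|l + ρ|² - |ρ|²) v` (`E_{ab} v = 0` for `a < b`,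
  `E_{ab}E_{ba} v = [E_{ab}, E_{ba}] v = (E_{aa} - E_{bb}) v`); **`aeval_harishChandra_casimirZ`** —
  `γ(C)(x) = ∑_a x_a² - ∑_a ρ_a²` for every Harish-Chandra homomorphism `γ` of `𝔤𝔩ₙ(ℝ)`;
  **`lift_casimir_eq_of_hasHCParameter`** — on a `𝔤𝔩ₙ(ℝ)`-module of Harish-Chandra parameter `χ` the
  Casimir element acts by `∑_{s ∈ χ} s² - ∑_a ρ_a²`; `sum_rho_single_apply_of_hasHCParameter` (applied form);
* complex case: `cas_apply_of_isHighestWeightVector` — the Casimir operator `C_τ` of the factor `τ` of a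
  factorwise representation on a highest weight vector is `∑_a l_{τ,a}² + 2 ∑_a ρ_a l_{τ,a}`;
  **`aeval_hc_casPlus`** — `γ(C₊)(x) = 2 ∑_τ (∑_a x_{τ,a}² - ∑_a ρ_a²)` (`C₊ = 2 (C_id + C_conj)` through
  the model, `GLnComplexCasimir.lift_casPlus`); **`lift_casPlus_eq_of_hasHCParameter`** — on a
  `𝔤𝔩ₙ(ℂ)`-module of Harish-Chandra parameter `χ`, `C₊` acts by `2 ∑_τ (∑_{s ∈ χ(τ)} s² - ∑_a ρ_a²)`.

These are the values of the trace-form Casimir operator on the archimedean components of an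
automorphic representation of `GL_n` with a given Harish-Chandra parameter, place by place (the Casimir
scalar `|λ^∨ + ρ|² - |ρ|² = |λ + ρ|² - |ρ|²` of a cohomological `π_∞`, input (i) of the Kuga reduction
of Clozel's Lemme 3.14 in `ResGLnCuspidalCohomologyApexKuga`).

## References

* A. W. Knapp, *Lie Groups Beyond an Introduction*, 2nd ed. (2002), §V.4 (Prop. 5.24, (5.24)), §V.5
  (Lemma 5.42, (5.43), Thm. 5.44), §VI.1. [Knapp2002]
* A. Borel, N. Wallach, *Continuous cohomology, discrete subgroups, and representations of reductive
  groups*, 2nd ed. (2000), I §2.3, II §3.1 (the Casimir scalar of a cohomological representation).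
  [BorelWallach2000]
-/

noncomputable section

-- Mathlib idiom (Mathlib/Algebra/Lie/OfAssociative.lean), as in `GL2CasimirScalar` and `HarishChandraGL`: commutator
-- brackets on matrix algebras and on `Module.End` (the Lie algebras `𝔤𝔩ₙ(𝕜)` and `End_ℂ V` of `HasHCParameter`).
attribute [local instance 100] LieRing.ofAssociativeRing

open scoped Matrix ComplexConjugate
open UniversalEnvelopingAlgebra Complex

namespace Literature.NumberTheory.Automorphic

/-! ### The scalar `∑_a f_a² + ∑_{a<b} (f_a - f_b) = |f + ρ|² - |ρ|²` -/

namespace GLnCasimir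

open HCSpan HCWt HCProj

variable {n : ℕ}

/-- `#{b | a < b} + a + 1 = n` in `Fin n`. [folklore] -/
theorem card_Ioi_add (a : Fin n) : (Finset.Ioi a).card + (a : ℕ) + 1 = n := by
  rw [Fin.card_Ioi]
  have := a.is_lt
  omega

/-- **`∑_{a<b} (f_a - f_b) = 2 ∑_a ρ_a f_a`** for `ρ_a = (n - 1)/2 - a`: the coefficient of `f_a` is
`#{b | a < b} - #{b | b < a} = (n - 1 - a) - a = 2ρ_a`. [cite: Knapp2002, §V.5 (5.43)] -/
theorem sum_sum_ite_lt_sub (f : Fin n → ℂ) :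
    (∑ a : Fin n, ∑ b : Fin n, if a < b then f a - f b else (0 : ℂ)) = 2 * ∑ a : Fin n, rhoGL n a * f a := by
  have h1 : (∑ a : Fin n, ∑ b : Fin n, if a < b then f a - f b else (0 : ℂ)) =
      (∑ a : Fin n, ∑ b : Fin n, if a < b then f a else (0 : ℂ)) -
        ∑ a : Fin n, ∑ b : Fin n, if a < b then f b else (0 : ℂ) := by
    rw [← Finset.sum_sub_distrib]
    refine Finset.sum_congr rfl fun a _ => ?_
    rw [← Finset.sum_sub_distrib]
    refine Finset.sum_congr rfl fun b _ => ?_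
    split_ifs <;> simp
  have h2 : ∀ a : Fin n, (∑ b : Fin n, if a < b then f a else (0 : ℂ)) = ((n : ℂ) - 1 - (a : ℕ)) * f a := by
    intro a
    rw [Finset.sum_ite, Finset.sum_const_zero, add_zero, Finset.sum_const, Finset.filter_lt_eq_Ioi,
      nsmul_eq_mul]
    have hc : (((Finset.Ioi a).card : ℕ) : ℂ) = (n : ℂ) - 1 - (a : ℕ) := by
      have h := congrArg (fun m : ℕ => (m : ℂ)) (card_Ioi_add a)
      simp only [Nat.cast_add, Nat.cast_one] at h
      linear_combination h
    rw [hc]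
  have h3 : (∑ a : Fin n, ∑ b : Fin n, if a < b then f b else (0 : ℂ)) = ∑ b : Fin n, ((b : ℕ) : ℂ) * f b := by
    rw [Finset.sum_comm]
    refine Finset.sum_congr rfl fun b _ => ?_
    rw [Finset.sum_ite, Finset.sum_const_zero, add_zero, Finset.sum_const, Finset.filter_gt_eq_Iio,
      nsmul_eq_mul, Fin.card_Iio]
  rw [h1, h3, Finset.mul_sum, ← Finset.sum_sub_distrib]
  refine Finset.sum_congr rfl fun a _ => ?_
  rw [h2 a, rhoGL]
  ring

/-- **The highest-weight Casimir scalar**: `∑_{a,b} (δ_{ab} f_a² + [a<b] (f_a - f_b)) = ∑_a f_a² + 2 ∑_a ρ_a f_a`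
(`= |f + ρ|² - |ρ|²`). [cite: Knapp2002, §V.5 (5.43)] -/
theorem hwCasimirScalar (f : Fin n → ℂ) :
    (∑ a : Fin n, ∑ b : Fin n, ((if a = b then f a ^ 2 else (0 : ℂ)) + (if a < b then f a - f b else (0 : ℂ)))) =
      ∑ a : Fin n, f a ^ 2 + 2 * ∑ a : Fin n, rhoGL n a * f a := by
  simp only [Finset.sum_add_distrib]
  rw [sum_sum_ite_lt_sub]
  congr 1
  refine Finset.sum_congr rfl fun a _ => ?_
  rw [Finset.sum_ite_eq]
  simp

/-- `∑_a (x_a - ρ_a)² + 2 ∑_a ρ_a (x_a - ρ_a) = ∑_a x_a² - ∑_a ρ_a²`. [folklore] -/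
theorem hwCasimirScalar_sub_rho (x : Fin n → ℂ) :
    ∑ a : Fin n, (x a - rhoGL n a) ^ 2 + 2 * ∑ a : Fin n, rhoGL n a * (x a - rhoGL n a) =
      ∑ a : Fin n, x a ^ 2 - ∑ a : Fin n, rhoGL n a ^ 2 := by
  rw [Finset.mul_sum, ← Finset.sum_add_distrib, ← Finset.sum_sub_distrib]
  refine Finset.sum_congr rfl fun a _ => ?_
  ring

/-- The enumerated sum of squares of a multiset: `∑_{s ∈ univ.map l} s² = ∑_a (l a)²`. [folklore] -/
theorem multiset_map_sq_sum_eq (l : Fin n → ℂ) :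
    ((Finset.univ.val.map l).map fun s : ℂ => s ^ 2).sum = ∑ a : Fin n, l a ^ 2 := by
  rw [Multiset.map_map, Finset.sum_eq_multiset_sum]
  rfl

/-! ### `𝕜 = ℝ`: the Casimir element `C = ∑ E_{ab} E_{ba}` -/

section Real

variable {V : Type*} [AddCommGroup V] [Module ℂ V] {ρ : Matrix (Fin n) (Fin n) ℝ →ₗ⁅ℝ⁆ Module.End ℂ V}
  {l : ArchWeightGL ℝ n} {v : V}

/-- `E_{aa} v = l_a v` on a highest weight vector of weight `l` (`ℝ → ℂ` has one embedding). [folklore] -/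
theorem rho_single_self_apply (hv : IsHighestWeightVector ρ l v) (τ : ℝ →ₐ[ℝ] ℂ) (a : Fin n) :
    ρ (Matrix.single a a (1 : ℝ)) v = l τ a • v := by
  rw [← Matrix.diagonal_single, hv.2.2, FactorRep.weightFun_single, Fintype.sum_subsingleton _ τ, map_one,
    mul_one]

/-- `E_{ab} v = 0` for `a < b` on a highest weight vector. [folklore] -/
theorem rho_single_apply_of_lt (hv : IsHighestWeightVector ρ l v) {a b : Fin n} (hab : a < b) :
    ρ (Matrix.single a b (1 : ℝ)) v = 0 :=
  hv.2.1 _ (single_mem_upperNilpLie hab _)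

/-- `E_{ab} E_{ba} v = [E_{ab}, E_{ba}] v = (l_a - l_b) v` for `a < b` on a highest weight vector.
[cite: Knapp2002, §V.5 Lemma 5.42] -/
theorem rho_single_rho_single_apply_of_lt (hv : IsHighestWeightVector ρ l v) (τ : ℝ →ₐ[ℝ] ℂ) {a b : Fin n}
    (hab : a < b) :
    ρ (Matrix.single a b (1 : ℝ)) (ρ (Matrix.single b a (1 : ℝ)) v) = (l τ a - l τ b) • v := by
  have h := LieHom.map_lie ρ (Matrix.single a b (1 : ℝ)) (Matrix.single b a (1 : ℝ))
  rw [single_lie_single, Ring.lie_def] at h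
  simp only [if_true, mul_one, map_sub] at h
  have hv' := LinearMap.congr_fun h v
  rw [LinearMap.sub_apply, LinearMap.sub_apply, Module.End.mul_apply, Module.End.mul_apply,
    rho_single_apply_of_lt hv hab, map_zero, sub_zero, rho_single_self_apply hv τ, rho_single_self_apply hv τ,
    ← sub_smul] at hv'
  exact hv'.symm

/-- **The Casimir element on a highest weight vector** of weight `l`:
`∑_{a,b} E_{ab} E_{ba} v = (∑_a l_a² + 2 ∑_a ρ_a l_a) v` (`= (|l + ρ|² - |ρ|²) v`).
[cite: Knapp2002, §V.5 Lemma 5.42, (5.43)] -/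
theorem sum_rho_single_rho_single_apply (hv : IsHighestWeightVector ρ l v) (τ : ℝ →ₐ[ℝ] ℂ) :
    (∑ a : Fin n, ∑ b : Fin n, ρ (Matrix.single a b (1 : ℝ)) (ρ (Matrix.single b a (1 : ℝ)) v)) =
      (∑ a : Fin n, l τ a ^ 2 + 2 * ∑ a : Fin n, rhoGL n a * l τ a) • v := by
  have hterm : ∀ a b : Fin n, ρ (Matrix.single a b (1 : ℝ)) (ρ (Matrix.single b a (1 : ℝ)) v) =
      ((if a = b then l τ a ^ 2 else (0 : ℂ)) + (if a < b then l τ a - l τ b else (0 : ℂ))) • v := by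
    intro a b
    rcases lt_trichotomy a b with hab | rfl | hba
    · rw [if_neg hab.ne, if_pos hab, zero_add, rho_single_rho_single_apply_of_lt hv τ hab]
    · rw [if_pos rfl, if_neg (lt_irrefl a), add_zero, rho_single_self_apply hv τ, map_smul,
        rho_single_self_apply hv τ, smul_smul, sq]
    · rw [if_neg hba.ne', if_neg (not_lt.2 hba.le), add_zero, rho_single_apply_of_lt hv hba, map_zero, zero_smul]
  simp only [hterm, ← Finset.sum_smul]
  rw [hwCasimirScalar]

/-- **The Casimir element `C = ∑ ι(E_{ab}) ι(E_{ba})` of `U(𝔤𝔩ₙ(ℝ))` on a highest weight vector**: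
`C v = (∑_a l_a² + 2 ∑_a ρ_a l_a) v`. [cite: Knapp2002, §V.5 (5.43)] -/
theorem lift_casimir_apply_of_isHighestWeightVector (hv : IsHighestWeightVector ρ l v) (τ : ℝ →ₐ[ℝ] ℂ) :
    lift ℝ ρ (casimir n) v = (∑ a : Fin n, l τ a ^ 2 + 2 * ∑ a : Fin n, rhoGL n a * l τ a) • v := by
  simp only [casimir_eq_sum, map_sum, LinearMap.sum_apply]
  rw [← sum_rho_single_rho_single_apply hv τ]
  refine Finset.sum_congr rfl fun a _ => Finset.sum_congr rfl fun b _ => ?_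
  rw [lift_mul_apply, lift_ιU_apply, lift_ιU_apply]

/-- **The Harish-Chandra polynomial of the Casimir element of `𝔤𝔩ₙ(ℝ)` is `∑_a x_a² - ∑_a ρ_a²`**
(`ρ_a = (n-1)/2 - a`), for every Harish-Chandra homomorphism `γ`: evaluate on the highest weight vector
of weight `x - ρ` of the model of `HarishChandraGLModel`. [cite: Knapp2002, Thm. 5.44 with (5.43)] -/
theorem aeval_harishChandra_casimirZ (γ : HarishChandraHomGL ℝ n) (x : (ℝ →ₐ[ℝ] ℂ) → Fin n → ℂ)
    (τ : ℝ →ₐ[ℝ] ℂ) :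
    MvPolynomial.aeval (fun p : (ℝ →ₐ[ℝ] ℂ) × Fin n => x p.1 p.2) (γ.toAlgHom (casimirZ n)) =
      ∑ a : Fin n, x τ a ^ 2 - ∑ a : Fin n, rhoGL n a ^ 2 := by
  set lam : ArchWeightGL ℝ n := fun σ i => x σ i - rhoGL n i with hlam
  have hv := HCModel.isHighestWeightVector_hwVec (𝕜 := ℝ) (n := n) lam
  have key := γ.highestWeight _ (HCModel.modelRep ℝ n).rho lam (HCModel.hwVec lam) hv (casimirZ n)
  have hx : (fun p : (ℝ →ₐ[ℝ] ℂ) × Fin n => lam p.1 p.2 + rhoGL n p.2) = fun p => x p.1 p.2 := by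
    funext p; simp [hlam]
  rw [hx] at key
  change lift ℝ (HCModel.modelRep ℝ n).rho (casimir n) (HCModel.hwVec lam) = _ at key
  rw [lift_casimir_apply_of_isHighestWeightVector hv τ] at key
  rw [← smul_hwVec_injective (𝕜 := ℝ) (n := n) lam key]
  exact hwCasimirScalar_sub_rho (x τ)

/-- **On a `𝔤𝔩ₙ(ℝ)`-module of Harish-Chandra parameter `χ` the Casimir element acts by
`∑_{s ∈ χ} s² - ∑_a ρ_a²`** (its infinitesimal character evaluates `γ(C)` at an enumeration of `χ`).
For `n = 2` this is `s₁² + s₂² - ½` (`GL2Casimir.lift_casimir_eq_of_hasHCParameter`).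
[cite: Knapp2002, Thm. 5.44] -/
theorem lift_casimir_eq_of_hasHCParameter {χ : (ℝ →ₐ[ℝ] ℂ) → Multiset ℂ} (h : HasHCParameter ρ χ)
    (τ : ℝ →ₐ[ℝ] ℂ) :
    lift ℝ ρ (casimir n) =
      algebraMap ℂ (Module.End ℂ V) (((χ τ).map fun s : ℂ => s ^ 2).sum - ∑ a : Fin n, rhoGL n a ^ 2) := by
  classical
  obtain ⟨hcard, θ, hθ, hγ⟩ := h
  choose l hl using fun σ => exists_enum_of_card_eq' (χ σ) (hcard σ)
  obtain ⟨γ⟩ := nonempty_harishChandraHomGL_holds ℝ n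
  have h1 := hθ (casimirZ n)
  have h2 := hγ γ l hl (casimirZ n)
  rw [aeval_harishChandra_casimirZ γ l τ] at h2
  change lift ℝ ρ (casimir n) = _ at h1
  rw [h1, h2, ← hl τ, multiset_map_sq_sum_eq]

/-- The same in applied form: `∑_{a,b} ρ(E_{ab}) ρ(E_{ba}) v = (∑_{s ∈ χ} s² - ∑_a ρ_a²) v`.
[cite: Knapp2002, Thm. 5.44] -/
theorem sum_rho_single_apply_of_hasHCParameter {χ : (ℝ →ₐ[ℝ] ℂ) → Multiset ℂ} (h : HasHCParameter ρ χ)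
    (τ : ℝ →ₐ[ℝ] ℂ) (w : V) :
    (∑ a : Fin n, ∑ b : Fin n, ρ (Matrix.single a b (1 : ℝ)) (ρ (Matrix.single b a (1 : ℝ)) w)) =
      (((χ τ).map fun s : ℂ => s ^ 2).sum - ∑ a : Fin n, rhoGL n a ^ 2) • w := by
  have h1 := congrArg (fun T : Module.End ℂ V => T w) (lift_casimir_eq_of_hasHCParameter h τ)
  simp only [casimir_eq_sum, map_sum, LinearMap.sum_apply, Module.algebraMap_end_apply] at h1
  rw [← h1]
  refine Finset.sum_congr rfl fun a _ => Finset.sum_congr rfl fun b _ => ?_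
  rw [lift_mul_apply, lift_ιU_apply, lift_ιU_apply]

end Real

end GLnCasimir

/-! ### `𝕜 = ℂ`: the real Casimir element `C₊` of `Re tr(XY)` -/

namespace GLnComplexCasimir

open HCSpan HCWt HCProj

variable {n : ℕ} {V : Type*} [AddCommGroup V] [Module ℂ V]

/-- **The Casimir operator of a factor on a highest weight vector**, every `n`: for a factorwise
representation `Ψ` of `𝔤𝔩ₙ(ℂ)_ℂ = 𝔤𝔩ₙ(ℂ) × 𝔤𝔩ₙ(ℂ)` and a highest weight vector `v` of weight `l` of its real
form, `C_τ v = (∑_a l_{τ,a}² + 2 ∑_a ρ_a l_{τ,a}) v` (`Ψ_τ(E_{ab}) v = 0` for `a < b`,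
`Ψ_τ(E_{ab}) Ψ_τ(E_{ba}) v = (Ψ_τ(E_{aa}) - Ψ_τ(E_{bb})) v`).  For `n = 2` this is
`GL2ComplexCasimir.cas_apply_of_isHighestWeightVector`. [cite: Knapp2002, §V.5 (5.43), §VI.1] -/
theorem cas_apply_of_isHighestWeightVector (Ψ : FactorRep ℂ n V) {l : ArchWeightGL ℂ n} {v : V}
    (hv : IsHighestWeightVector Ψ.rho l v) (τ : ℂ →ₐ[ℝ] ℂ) :
    cas Ψ τ v = (∑ a : Fin n, l τ a ^ 2 + 2 * ∑ a : Fin n, rhoGL n a * l τ a) • v := by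
  have hterm : ∀ a b : Fin n, Ψ.toFun τ (Matrix.single a b 1) (Ψ.toFun τ (Matrix.single b a 1) v) =
      ((if a = b then l τ a ^ 2 else (0 : ℂ)) + (if a < b then l τ a - l τ b else (0 : ℂ))) • v := by
    intro a b
    change Ψ.E τ a b (Ψ.E τ b a v) = _
    rcases lt_trichotomy a b with hab | rfl | hba
    · have h := LinearMap.congr_fun (Ψ.E_mul_E_sub τ a b b a) v
      simp only [LinearMap.sub_apply, Module.End.mul_apply, Ψ.E_apply_eq_zero hv τ hab, map_zero, sub_zero,
        if_true] at h
      rw [h, Ψ.E_diag_apply hv τ a, Ψ.E_diag_apply hv τ b, if_neg hab.ne, if_pos hab, zero_add, sub_smul]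
    · rw [Ψ.E_diag_apply hv τ a, map_smul, Ψ.E_diag_apply hv τ a, smul_smul, if_pos rfl, if_neg (lt_irrefl a),
        add_zero, sq]
    · rw [Ψ.E_apply_eq_zero hv τ hba, map_zero, if_neg hba.ne', if_neg (not_lt.2 hba.le), add_zero, zero_smul]
  simp only [cas, LinearMap.sum_apply, Module.End.mul_apply, hterm, ← Finset.sum_smul]
  rw [GLnCasimir.hwCasimirScalar]

/-- **The Harish-Chandra polynomial of `C₊` is `2 ∑_τ (∑_a x_{τ,a}² - ∑_a ρ_a²)`**, every `n`, for every
Harish-Chandra homomorphism `γ` of `𝔤𝔩ₙ(ℂ)` (as a real Lie algebra): `C₊ = 2 (C_id + C_conj)` through the model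
of `HarishChandraGLModel` (`lift_casPlus`), evaluated on its highest weight vector of weight `x - ρ`.
For `n = 2` this is `GL2ComplexCasimir.aeval_hc_casPlus`. [cite: Knapp2002, Thm. 5.44, §VI.1] -/
theorem aeval_hc_casPlus (γ : HarishChandraHomGL ℂ n) (x : (ℂ →ₐ[ℝ] ℂ) → Fin n → ℂ) :
    MvPolynomial.aeval (fun p : (ℂ →ₐ[ℝ] ℂ) × Fin n => x p.1 p.2)
        (γ.toAlgHom ⟨casPlus n, casPlus_mem_center n⟩) =
      2 * ∑ τ : ℂ →ₐ[ℝ] ℂ, (∑ a : Fin n, x τ a ^ 2 - ∑ a : Fin n, rhoGL n a ^ 2) := by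
  set lam : ArchWeightGL ℂ n := fun σ i => x σ i - rhoGL n i with hlam
  have hv := HCModel.isHighestWeightVector_hwVec (𝕜 := ℂ) (n := n) lam
  have key := γ.highestWeight _ (HCModel.modelRep ℂ n).rho lam (HCModel.hwVec lam) hv
    ⟨casPlus n, casPlus_mem_center n⟩
  have hx : (fun p : (ℂ →ₐ[ℝ] ℂ) × Fin n => lam p.1 p.2 + rhoGL n p.2) = fun p => x p.1 p.2 := by
    funext p; simp [hlam]
  rw [hx] at key
  change lift ℝ (HCModel.modelRep ℂ n).rho (casPlus n) (HCModel.hwVec lam) = _ at key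
  rw [lift_casPlus, LinearMap.smul_apply, LinearMap.add_apply, cas_apply_of_isHighestWeightVector _ hv,
    cas_apply_of_isHighestWeightVector _ hv, ← add_smul, smul_smul] at key
  rw [← smul_hwVec_injective (𝕜 := ℂ) (n := n) lam key, sum_algHom, GLnCasimir.hwCasimirScalar_sub_rho,
    GLnCasimir.hwCasimirScalar_sub_rho]

/-- **On a `𝔤𝔩ₙ(ℂ)`-module of Harish-Chandra parameter `χ`, `C₊` acts by `2 ∑_τ (∑_{s ∈ χ(τ)} s² - ∑_a ρ_a²)`**
(`τ ∈ {id, conj}`).  For `n = 2`: `C₊ = 2 (C_L + C_R)` with `C_L = s₁² + s₂² - ½`, `C_R = t₁² + t₂² - ½`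
(`GLnComplexCasimir.scalars_of_hasHCParameter`). [cite: Knapp2002, Thm. 5.44, §VI.1] -/
theorem lift_casPlus_eq_of_hasHCParameter {ρ : Matrix (Fin n) (Fin n) ℂ →ₗ⁅ℝ⁆ Module.End ℂ V}
    {χ : (ℂ →ₐ[ℝ] ℂ) → Multiset ℂ} (h : HasHCParameter ρ χ) :
    lift ℝ ρ (casPlus n) =
      algebraMap ℂ (Module.End ℂ V)
        (2 * ∑ τ : ℂ →ₐ[ℝ] ℂ, (((χ τ).map fun s : ℂ => s ^ 2).sum - ∑ a : Fin n, rhoGL n a ^ 2)) := by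
  classical
  obtain ⟨hcard, θ, hθ, hγ⟩ := h
  choose l hl using fun σ => exists_enum_of_card_eq' (χ σ) (hcard σ)
  obtain ⟨γ⟩ := nonempty_harishChandraHomGL_holds ℂ n
  have h1 := hθ ⟨casPlus n, casPlus_mem_center n⟩
  have h2 := hγ γ l hl ⟨casPlus n, casPlus_mem_center n⟩
  rw [aeval_hc_casPlus γ l] at h2
  change lift ℝ ρ (casPlus n) = _ at h1
  rw [h1, h2]
  congr 2
  refine Finset.sum_congr rfl fun τ _ => ?_
  rw [← hl τ, GLnCasimir.multiset_map_sq_sum_eq]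

end GLnComplexCasimir

end Literature.NumberTheory.Automorphic

end
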